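import Literature.Barriers.CriticalPhenomena.FKParafermionicHalfCauchyRiemann
import HarnessLib

noncomputable section
namespace Summit.CriticalPhenomena.CardyFormulaZ2.Cruxes.ParafermionToSLESixFamilies.Ideator5
open Literature.Probability.LatticeModels
open Literature.Barriers.CriticalPhenomena
open Literature.Barriers.CriticalPhenomena.HalfCRGreen

def medialPos (p : Site 2 × Fin 2) : ℂ :=
  ((p.1 0 : ℤ) : ℂ) + ((p.1 1 : ℤ) : ℂ) * Complex.I +
    (if p.2 = 0 then (1 / 2 : ℂ) else Complex.I / 2)

theorem bergmanSplitHol (x : Site 2) (i : Fin 2) (k : Fin 4) :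
    coeff Complex.I k * (medialPos (x, i) - medialPos (twin x i k)) =
      (1 - Complex.I) / 2 * (-1 : ℂ) ^ (k : ℕ) := by
  fin_cases i <;> fin_cases k <;>
    simp [medialPos, twin, coeff, Pi.single_apply] <;> ring_nf <;>
    simp [Complex.ext_iff] <;> norm_num

theorem bergmanSplitAnti (x : Site 2) (i : Fin 2) (k : Fin 4) :
    coeff Complex.I k *
        ((starRingEnd ℂ) (medialPos (x, i)) - (starRingEnd ℂ) (medialPos (twin x i k))) =
      (1 + Complex.I) / 2 := by
  fin_cases i <;> fin_cases k <;>
    simp [medialPos, twin, coeff, Pi.single_apply, map_add, map_mul, Complex.conj_I] <;> ring_nf <;>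
    simp [Complex.ext_iff] <;> norm_num

end Summit.CriticalPhenomena.CardyFormulaZ2.Cruxes.ParafermionToSLESixFamilies.Ideator5
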